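import Literature.NumberTheory.LFunctions.XiJensenRows
import Literature.Analysis.Complex.HadamardGenusZeroProofs
import Mathlib.Analysis.Calculus.LogDerivUniformlyOn
import Mathlib.Analysis.Normed.Module.MultipliableUniformlyOn
import HarnessLib

/-!
# The zeros of every derivative of `ξ₁(z) = ξ(½ + √z)` lie in the image of the closed critical strip

Topic: Number theory / L-functions (`Literature/NumberTheory/LFunctions`). RH-FREE structural fact
about the derivatives `ξ₁⁽ⁿ⁾ = iteratedDeriv n xiSq` of the tree's `xiSq` (`G(z) = ξ(½ + z^{1/2})`,
`Literature/NumberTheory/LFunctions/ZetaLogDerivSeries.lean`); nothing here bears on the truth of RH.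

**The statement.** For every `n` and every zero `z` of `ξ₁⁽ⁿ⁾`,

  `(Im z)² + Re z ≤ 1/4`,

i.e. `z` lies in the closed parabolic region `P = {x + iy : y² ≤ ¼ − x}`, which is exactly the image
of the closed critical strip `{|Re u| ≤ ½}` under `u ↦ u²` (`(a + iT)² ∈ P ⟺ a² ≤ ¼`).
Consequences: a zero
`u²` of `ξ₁⁽ⁿ⁾` has `|Re u| ≤ ½` (`abs_re_le_half_of_iteratedDeriv_xiSq_sq_eq_zero`), and a zero with
`Re z ≥ 0` has `‖z‖ ≤ ½` (`norm_le_half_of_iteratedDeriv_xiSq_eq_zero`) — so, e.g., no derivative of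
`ξ₁` vanishes at a point `z` with `Re z ≥ 0`, `‖z‖ > ½`.

**The proof** is the Gauss–Lucas argument for entire functions of genus zero (Laguerre; Pólya–Schur
theory, e.g. Levin, *Distribution of zeros of entire functions*, Ch. VIII §1; Boas, *Entire
Functions*, §2.8): `ξ₁⁽ⁿ⁾` is entire of order `≤ 7/8 < 1` with `ξ₁⁽ⁿ⁾(0) = γ(n)/8 ≠ 0`
(tree `exists_growth_iteratedDeriv_xiSq`, `eight_mul_iteratedDeriv_xiSq_zero_ne`), so by Hadamard's
theorem in genus zero (tree `Literature.Analysis.Complex.hadamard_genus_zero_holds`)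
`ξ₁⁽ⁿ⁾(z) = ξ₁⁽ⁿ⁾(0) ∏ (1 − z/aₖ)` and `(ξ₁⁽ⁿ⁾)'/ξ₁⁽ⁿ⁾ = Σₖ 1/(z − aₖ)` (Mathlib
`logDeriv_tprod_eq_tsum`). If all `aₖ` lie in a closed half-plane `H` and `z ∉ H`, every
`1/(z − aₖ)` lies in one open half-plane, so the sum is non-zero: the zeros of the derivative stay in
`H` (`GenusZeroLucas.deriv_ne_zero_of_zeros_re_le`). The region `P` is convex (an intersection of
the half-planes `Re w + 2y₀ Im w ≤ ¼ + y₀²`), the zeros of `ξ₁` itself are the points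
`(ρ − ½)²`, `0 < Re ρ < 1` (`riemannXi_eq_zero_iff_holds`), which lie in `P`; induction on `n`.

## Main statements (all proved, axioms standard)

* `GenusZeroLucas.exists_data`, `….logDeriv_eq_tsum`, `….deriv_ne_zero_of_zeros_re_le` — the
  genus-zero Gauss–Lucas lemma for a closed half-plane `{w : Re (e · w) ≤ m}` (generic `f`).
* `sq_im_add_re_le_quarter_of_xiSq_eq_zero` — the case `n = 0`.
* `sq_im_add_re_le_quarter_of_iteratedDeriv_xiSq_eq_zero` — THE THEOREM, every `n`.
* `abs_re_le_half_of_iteratedDeriv_xiSq_sq_eq_zero`, `norm_le_half_of_iteratedDeriv_xiSq_eq_zero`,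
  `iteratedDeriv_xiSq_ne_zero_of_re_nonneg` — the strip / right-half-plane corollaries.

## References

* B. Ja. Levin, *Distribution of zeros of entire functions*, AMS 1964, Ch. VIII §1 (Laguerre's
  theorem on genus-zero functions).
* J. B. Conway, *Functions of One Complex Variable I*, GTM 11, Ch. XI Thm. 3.4 (Hadamard).
* E. C. Titchmarsh, *The theory of the Riemann zeta-function*, 2nd ed., §2.12 (zeros of `ξ`).
-/

noncomputable section

open Complex Filter Topology
open scoped ComplexConjugate

namespace Literature.NumberTheory.LFunctions

/-! ## Gauss–Lucas for entire functions of genus zero -/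

namespace GenusZeroLucas

variable {f : ℂ → ℂ}

/-- **Hadamard data** for an entire `f` of order `< 1` with `f(0) ≠ 0`: inverse zeros `bₖ` with
`Σ ‖bₖ‖ < ∞` and `∏ (1 − bₖ z) = f(z)/f(0)` (tree `hadamard_genus_zero_holds`).
[cite: Conway1978, Ch. XI Thm. 3.4] -/
theorem exists_data (hf : Differentiable ℂ f) {ρ C : ℝ} (hρ : ρ < 1)
    (hgr : ∀ z, ‖f z‖ ≤ C * Real.exp (‖z‖ ^ ρ)) (h0 : f 0 ≠ 0) :
    ∃ b : ℕ → ℂ, Summable (fun n => ‖b n‖) ∧ ∀ z : ℂ, HasProd (fun n => 1 - b n * z) (f z / f 0) :=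
  Literature.Analysis.Complex.hadamard_genus_zero_holds f ρ C hf hρ hgr h0

section data

variable {b : ℕ → ℂ}

/-- An inverse zero `bₖ ≠ 0` gives the zero `1/bₖ` of `f`. [folklore] -/
private theorem apply_inv_eq_zero (hprod : ∀ z : ℂ, HasProd (fun n => 1 - b n * z) (f z / f 0))
    (h0 : f 0 ≠ 0) {n : ℕ} (hn : b n ≠ 0) : f (b n)⁻¹ = 0 := by
  have h := hasProd_zero_of_eq_zero (hprod (b n)⁻¹) (n := n) (by field_simp; ring)
  rcases div_eq_zero_iff.1 h with h | h
  · exact h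
  · exact absurd h h0

/-- At a point where `f ≠ 0` no factor `1 − bₖ z` vanishes. [folklore] -/
private theorem factor_ne_zero (hprod : ∀ z : ℂ, HasProd (fun n => 1 - b n * z) (f z / f 0))
    (h0 : f 0 ≠ 0) {x : ℂ} (hx : f x ≠ 0) (n : ℕ) : 1 - b n * x ≠ 0 := by
  intro h
  have := hasProd_zero_of_eq_zero (hprod x) h
  rcases div_eq_zero_iff.1 this with h' | h'
  · exact hx h'
  · exact h0 h'

/-- If all inverse zeros vanish, `f` is constant. [folklore] -/
private theorem eq_apply_zero_of_forall_eq_zero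
    (hprod : ∀ z : ℂ, HasProd (fun n => 1 - b n * z) (f z / f 0)) (h0 : f 0 ≠ 0)
    (hzero : ∀ n, b n = 0) (z : ℂ) : f z = f 0 := by
  have h1 : HasProd (fun n => 1 - b n * z) 1 := by
    have : (fun n => 1 - b n * z) = fun _ => (1 : ℂ) := by
      funext n; simp [hzero n]
    rw [this]; exact hasProd_one
  have h := (hprod z).unique h1
  rwa [div_eq_one_iff_eq h0] at h

/-- The log-derivative terms `−bₖ/(1 − bₖ x)` are absolutely summable. [folklore] -/
private theorem summable_norm_logDeriv_factor (hb : Summable fun n => ‖b n‖) (x : ℂ) :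
    Summable fun n => ‖-b n / (1 - b n * x)‖ := by
  have hb0 : Tendsto (fun n => b n) atTop (𝓝 0) :=
    tendsto_zero_iff_norm_tendsto_zero.2 hb.tendsto_atTop_zero
  have hev : ∀ᶠ n in atTop, ‖b n * x‖ ≤ 1 / 2 := by
    have : Tendsto (fun n => b n * x) atTop (𝓝 0) := by simpa using hb0.mul_const x
    exact (tendsto_zero_iff_norm_tendsto_zero.1 this).eventually
      (ge_mem_nhds (by norm_num : (0 : ℝ) < 1 / 2))
  refine Summable.of_norm_bounded_eventually (g := fun n => 2 * ‖b n‖) (hb.mul_left 2) ?_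
  rw [Nat.cofinite_eq_atTop]
  filter_upwards [hev] with n hn
  rw [norm_norm, norm_div, norm_neg]
  have h1 : 1 / 2 ≤ ‖1 - b n * x‖ := by
    have := norm_sub_norm_le (1 : ℂ) (b n * x)
    rw [norm_one] at this
    linarith
  rw [div_le_iff₀ (by linarith)]
  nlinarith [norm_nonneg (b n)]

/-- **Logarithmic derivative of the Hadamard product**: for `f(x) ≠ 0`,
`f'(x)/f(x) = Σₖ −bₖ/(1 − bₖ x)` (Mathlib `logDeriv_tprod_eq_tsum` on the disc `|z| < |x| + 1`,
where the product converges locally uniformly). [cite: Conway1978, Ch. XI Thm. 3.4] -/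
theorem logDeriv_eq_tsum (hb : Summable fun n => ‖b n‖)
    (hprod : ∀ z : ℂ, HasProd (fun n => 1 - b n * z) (f z / f 0)) (h0 : f 0 ≠ 0)
    {x : ℂ} (hx : f x ≠ 0) :
    logDeriv f x = ∑' n, -b n / (1 - b n * x) := by
  set K : Set ℂ := Metric.ball 0 (‖x‖ + 1) with hK
  have hKo : IsOpen K := Metric.isOpen_ball
  have hxK : x ∈ K := by simp [hK]
  set g : ℕ → ℂ → ℂ := fun n z => -(b n * z) with hg
  have hprod_fun : (fun z => ∏' n, (1 + g n z)) = fun z => (f 0)⁻¹ * f z := by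
    funext z
    have := (hprod z).tprod_eq
    simp only [hg, ← sub_eq_add_neg]
    rw [this]; field_simp
  have hmult : MultipliableLocallyUniformlyOn (fun n z => 1 + g n z) K := by
    refine Summable.multipliableLocallyUniformlyOn_nat_one_add hKo (u := fun n => ‖b n‖ * (‖x‖ + 1))
      (hb.mul_right _) (Eventually.of_forall fun n z hz => ?_) fun n => by fun_prop
    simp only [hg, norm_neg, norm_mul]
    have : ‖z‖ ≤ ‖x‖ + 1 := by
      simp only [hK, Metric.mem_ball, dist_zero_right] at hz; exact hz.le
    gcongr
  have hlog : ∀ n, logDeriv (fun z => 1 + g n z) x = -b n / (1 - b n * x) := by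
    intro n
    rw [logDeriv_apply]
    have hd : HasDerivAt (fun z => 1 + g n z) (-(b n * 1)) x := by
      simpa [hg] using ((hasDerivAt_id x).const_mul (b n)).neg.const_add 1
    rw [hd.deriv]
    simp only [hg, mul_one]
    ring
  have h := logDeriv_tprod_eq_tsum hKo hxK (f := fun n z => 1 + g n z)
    (fun n => by simpa [hg, sub_eq_add_neg] using factor_ne_zero hprod h0 hx n)
    (fun n => by fun_prop)
    (by simpa only [hlog] using (summable_norm_logDeriv_factor hb x).of_norm)
    hmult
    (by
      have := congrFun hprod_fun x
      rw [this]
      exact mul_ne_zero (inv_ne_zero h0) hx)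
  simp only [hlog] at h
  rw [hprod_fun, logDeriv_const_mul x _ (inv_ne_zero h0)] at h
  exact h

/-- One term of the log-derivative seen from outside a half-plane containing the zero: if
`Re (e·a) ≤ m < Re (e·z)` for the zero `a = 1/c` (`c ≠ 0`), then
`Re (ē · (−c/(1 − c z))) = Re (e (z − a)) / |z − a|² > 0`. [folklore] -/
private theorem re_mul_term_pos {e z : ℂ} {m : ℝ} {c : ℂ} (hc : c ≠ 0)
    (ha : (e * c⁻¹).re ≤ m) (hz : m < (e * z).re) :
    0 < (conj e * (-c / (1 - c * z))).re := by
  have hza : z - c⁻¹ ≠ 0 := by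
    intro h
    have : z = c⁻¹ := sub_eq_zero.1 h
    rw [this] at hz
    linarith
  have h1 : 1 - c * z = -c * (z - c⁻¹) := by field_simp; ring
  have hrew : -c / (1 - c * z) = (z - c⁻¹)⁻¹ := by
    rw [h1, div_mul_eq_div_div, div_self (neg_ne_zero.2 hc), one_div]
  rw [hrew, Complex.inv_def, ← mul_assoc, Complex.re_mul_ofReal]
  have hns : 0 < (Complex.normSq (z - c⁻¹))⁻¹ := inv_pos.2 (Complex.normSq_pos.2 hza)
  refine mul_pos ?_ hns
  have key : (conj e * conj (z - c⁻¹)).re = (e * z).re - (e * c⁻¹).re := by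
    rw [← map_mul, Complex.conj_re, mul_sub, Complex.sub_re]
  rw [key]
  linarith

/-- **Gauss–Lucas in genus zero (half-plane form).** Let `f` be entire with the Hadamard data
`(b, ∏ (1 − bₖ z) = f z / f 0)`, `Σ‖bₖ‖ < ∞`, and suppose every zero `a` of `f` satisfies
`Re (ē·a) ≤ m`. Then at any `z` with `Re (ē·z) > m`: `f(z) ≠ 0`, and either `f'(z) ≠ 0` or `f`
is constant (no zeros at all). [cite: Levin1964, Ch. VIII §1 (Laguerre's theorem)] -/
theorem deriv_ne_zero_of_zeros_re_le (hb : Summable fun n => ‖b n‖)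
    (hprod : ∀ z : ℂ, HasProd (fun n => 1 - b n * z) (f z / f 0)) (h0 : f 0 ≠ 0)
    {e : ℂ} {m : ℝ} (hzeros : ∀ a : ℂ, f a = 0 → (e * a).re ≤ m) {z : ℂ} (hz : m < (e * z).re) :
    f z ≠ 0 ∧ (deriv f z ≠ 0 ∨ ∀ w : ℂ, f w = f 0) := by
  have hfz : f z ≠ 0 := fun h => by have := hzeros z h; linarith
  refine ⟨hfz, ?_⟩
  by_cases hall : ∀ n, b n = 0
  · exact Or.inr (eq_apply_zero_of_forall_eq_zero hprod h0 hall)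
  left
  push Not at hall
  obtain ⟨n₀, hn₀⟩ := hall
  have hsum : Summable fun n => -b n / (1 - b n * z) :=
    (summable_norm_logDeriv_factor hb z).of_norm
  have hsum' : Summable fun n => conj e * (-b n / (1 - b n * z)) := hsum.mul_left (conj e)
  have hterm_nonneg : ∀ n, 0 ≤ (conj e * (-b n / (1 - b n * z))).re := by
    intro n
    by_cases hn : b n = 0
    · simp [hn]
    · exact (re_mul_term_pos hn (hzeros _ (apply_inv_eq_zero hprod h0 hn)) hz).le
  have hterm_pos : 0 < (conj e * (-b n₀ / (1 - b n₀ * z))).re :=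
    re_mul_term_pos hn₀ (hzeros _ (apply_inv_eq_zero hprod h0 hn₀)) hz
  have hre : 0 < (conj e * logDeriv f z).re := by
    rw [logDeriv_eq_tsum hb hprod h0 hfz, ← tsum_mul_left, Complex.re_tsum hsum']
    have hsumre : Summable fun n => (conj e * (-b n / (1 - b n * z))).re :=
      hsum'.mapL Complex.reCLM
    exact lt_of_lt_of_le hterm_pos (hsumre.le_tsum n₀ fun j _ => hterm_nonneg j)
  intro hd
  rw [logDeriv_apply, hd, zero_div, mul_zero, Complex.zero_re] at hre
  exact lt_irrefl _ hre

end data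

end GenusZeroLucas

/-! ## The parabolic region `P = {y² + x ≤ ¼}` = image of the closed critical strip under squaring -/

/-- `(u²).im² + (u²).re = u.re² (4 u.im² + 1) − u.im²`. [folklore] -/
private theorem sq_im_sq_add_re (u : ℂ) :
    (u ^ 2).im ^ 2 + (u ^ 2).re = u.re ^ 2 * (4 * u.im ^ 2 + 1) - u.im ^ 2 := by
  simp only [sq, Complex.mul_re, Complex.mul_im]
  ring

/-- `u² ∈ P ⟺ |Re u| ≤ ½`: if `(u²).im² + (u²).re ≤ ¼` then `(Re u)² ≤ ¼`. [folklore] -/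
private theorem sq_re_sq_le_quarter_of_mem_parabola {u : ℂ} (h : (u ^ 2).im ^ 2 + (u ^ 2).re ≤ 1 / 4) :
    u.re ^ 2 ≤ 1 / 4 := by
  rw [sq_im_sq_add_re] at h
  nlinarith [sq_nonneg u.im, sq_nonneg u.re, mul_nonneg (sq_nonneg u.re) (sq_nonneg u.im)]

/-- Conversely `|Re u| ≤ ½ ⟹ u² ∈ P`. [folklore] -/
private theorem mem_parabola_sq_of_re_sq_le_quarter {u : ℂ} (h : u.re ^ 2 ≤ 1 / 4) :
    (u ^ 2).im ^ 2 + (u ^ 2).re ≤ 1 / 4 := by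
  rw [sq_im_sq_add_re]
  nlinarith [sq_nonneg u.im, mul_nonneg (sq_nonneg u.re) (sq_nonneg u.im),
    mul_le_mul_of_nonneg_right h (sq_nonneg u.im)]

/-- **Supporting half-planes of `P`.** For `w ∈ P` and any real `y₀`:
`Re w + 2 y₀ Im w ≤ ¼ + y₀²` (tangent half-plane of the parabola at height `y₀`). [folklore] -/
private theorem re_add_mul_im_le_of_mem_parabola {w : ℂ} (hw : w.im ^ 2 + w.re ≤ 1 / 4) (y₀ : ℝ) :
    w.re + 2 * y₀ * w.im ≤ 1 / 4 + y₀ ^ 2 := by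
  nlinarith [sq_nonneg (w.im - y₀)]

/-- The same functional in the form `Re (e · w)` with `e = 1 − 2 y₀ i`. [folklore] -/
private theorem re_mul_eq_re_add (y₀ : ℝ) (w : ℂ) :
    (((1 : ℂ) - 2 * (y₀ : ℂ) * I) * w).re = w.re + 2 * y₀ * w.im := by
  simp only [Complex.mul_re, Complex.sub_re, Complex.sub_im, Complex.one_re, Complex.one_im,
    Complex.mul_im, Complex.re_ofNat, Complex.im_ofNat, Complex.ofReal_re, Complex.ofReal_im,
    Complex.I_re, Complex.I_im]
  ring

/-! ## The zeros of `ξ₁` and of all its derivatives lie in `P` -/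

/-- **Case `n = 0`:** every zero `z` of `ξ₁ = xiSq` satisfies `(Im z)² + Re z ≤ ¼`
(`z = (ρ − ½)²` with `ζ(ρ) = 0`, `0 < Re ρ < 1`, tree `riemannXi_eq_zero_iff_holds`).
[cite: Titchmarsh1986, §2.12] -/
theorem sq_im_add_re_le_quarter_of_xiSq_eq_zero {z : ℂ} (hz : xiSq z = 0) :
    z.im ^ 2 + z.re ≤ 1 / 4 := by
  set u : ℂ := z ^ (2⁻¹ : ℂ) with hu
  have hu2 : u ^ 2 = z := by
    rw [hu]; exact_mod_cast Complex.cpow_nat_inv_pow z two_ne_zero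
  have hξ : riemannXi (1 / 2 + u) = 0 := by rw [← xiSq_eq z]; exact hz
  obtain ⟨-, h0, h1⟩ := (riemannXi_eq_zero_iff_holds _).1 hξ
  simp only [Complex.add_re] at h0 h1
  norm_num at h0 h1
  rw [← hu2]
  apply mem_parabola_sq_of_re_sq_le_quarter
  nlinarith

/-- No derivative of `ξ₁` vanishes identically (`8 ξ₁⁽ᵏ⁾(0) = γ(k) ≠ 0`). [folklore] -/
private theorem iteratedDeriv_xiSq_ne_zero_fun (k : ℕ) : iteratedDeriv k xiSq ≠ 0 := by
  intro h
  have := eight_mul_iteratedDeriv_xiSq_zero_ne k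
  rw [h] at this
  simp at this

/-- **THE THEOREM (RH-free).** For every `n`, every zero `z` of `ξ₁⁽ⁿ⁾ = iteratedDeriv n xiSq`
satisfies `(Im z)² + Re z ≤ ¼`: the zeros of all derivatives of `ξ₁(z) = ξ(½ + √z)` stay in the
image `P` of the closed critical strip under `u ↦ u²`. (Gauss–Lucas for genus-zero functions,
`GenusZeroLucas.deriv_ne_zero_of_zeros_re_le`, applied inductively through the supporting
half-planes of the convex region `P`.) [cite: Levin1964, Ch. VIII §1 (Laguerre's theorem)] -/
theorem sq_im_add_re_le_quarter_of_iteratedDeriv_xiSq_eq_zero (n : ℕ) :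
    ∀ z : ℂ, iteratedDeriv n xiSq z = 0 → z.im ^ 2 + z.re ≤ 1 / 4 := by
  induction n with
  | zero =>
    intro z hz
    exact sq_im_add_re_le_quarter_of_xiSq_eq_zero (by simpa using hz)
  | succ n ih =>
    intro z hz
    by_contra hcon
    push Not at hcon
    set F : ℂ → ℂ := iteratedDeriv n xiSq with hF
    have hFd : Differentiable ℂ F := Literature.Analysis.Complex.differentiable_iteratedDeriv_of_entire differentiable_xiSq n
    have hF0 : F 0 ≠ 0 := by
      intro h
      have := eight_mul_iteratedDeriv_xiSq_zero_ne n
      rw [← hF, h, mul_zero] at this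
      exact this rfl
    obtain ⟨C, -, hgr⟩ := exists_growth_iteratedDeriv_xiSq n
    obtain ⟨b, hb, hprod⟩ :=
      GenusZeroLucas.exists_data hFd (ρ := 7 / 8) (by norm_num) hgr hF0
    -- the supporting half-plane `Re w + 2 y₀ Im w ≤ ¼ + y₀²`, `y₀ = Im z`, separates `z` from `P`
    set e : ℂ := (1 : ℂ) - 2 * (z.im : ℂ) * I with he
    set m : ℝ := 1 / 4 + z.im ^ 2 with hm
    have hzeros : ∀ a : ℂ, F a = 0 → (e * a).re ≤ m := by
      intro a ha
      rw [he, re_mul_eq_re_add]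
      exact re_add_mul_im_le_of_mem_parabola (ih a ha) z.im
    have hzout : m < (e * z).re := by
      rw [he, re_mul_eq_re_add, hm]
      nlinarith
    obtain ⟨-, halt⟩ := GenusZeroLucas.deriv_ne_zero_of_zeros_re_le hb hprod hF0 hzeros hzout
    have hderiv : deriv F z = 0 := by
      rw [hF, ← iteratedDeriv_succ]; exact hz
    rcases halt with h | hconst
    · exact h hderiv
    · -- `F` constant ⇒ `F' ≡ 0`, contradicting `ξ₁⁽ⁿ⁺¹⁾(0) ≠ 0`
      have hF' : iteratedDeriv (n + 1) xiSq = 0 := by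
        funext w
        rw [iteratedDeriv_succ, ← hF]
        have : F = fun _ => F 0 := funext hconst
        rw [this]
        simp
      exact iteratedDeriv_xiSq_ne_zero_fun (n + 1) hF'

/-- **Strip form.** If `ξ₁⁽ⁿ⁾(u²) = 0` then `|Re u| ≤ ½`: writing a zero of the `n`-th derivative as
`(s − ½)²`, the point `s` lies in the closed critical strip. [cite: Levin1964, Ch. VIII §1] -/
theorem abs_re_le_half_of_iteratedDeriv_xiSq_sq_eq_zero {n : ℕ} {u : ℂ}
    (hu : iteratedDeriv n xiSq (u ^ 2) = 0) : |u.re| ≤ 1 / 2 := by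
  have h := sq_re_sq_le_quarter_of_mem_parabola
    (sq_im_add_re_le_quarter_of_iteratedDeriv_xiSq_eq_zero n _ hu)
  have h2 : u.re ^ 2 ≤ (1 / 2) ^ 2 := by norm_num; linarith
  exact abs_le.2 (abs_le_of_sq_le_sq' h2 (by norm_num))

/-- **Right half-plane form.** A zero `z` of `ξ₁⁽ⁿ⁾` with `Re z ≥ 0` has `‖z‖ ≤ ½`.
[cite: Levin1964, Ch. VIII §1] -/
theorem norm_le_half_of_iteratedDeriv_xiSq_eq_zero {n : ℕ} {z : ℂ}
    (hz : iteratedDeriv n xiSq z = 0) (hre : 0 ≤ z.re) : ‖z‖ ≤ 1 / 2 := by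
  have h := sq_im_add_re_le_quarter_of_iteratedDeriv_xiSq_eq_zero n z hz
  have hre' : z.re ≤ 1 / 4 := by nlinarith [sq_nonneg z.im]
  have hsq : ‖z‖ ^ 2 ≤ (1 / 2) ^ 2 := by
    rw [Complex.sq_norm, Complex.normSq_apply]
    nlinarith
  exact (abs_le_of_sq_le_sq' hsq (by norm_num)).2

/-- **No derivative of `ξ₁` vanishes at a point `z` with `Re z ≥ 0` and `‖z‖ > ½`** (RH-free; the
`Re z ≥ 0` half of the band/edge analysis of the zeros of `ξ₁⁽ⁿ⁾` needs no saddle-point work).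
[cite: Levin1964, Ch. VIII §1] -/
theorem iteratedDeriv_xiSq_ne_zero_of_re_nonneg {n : ℕ} {z : ℂ} (hre : 0 ≤ z.re)
    (hnorm : 1 / 2 < ‖z‖) : iteratedDeriv n xiSq z ≠ 0 := fun hz =>
  absurd (norm_le_half_of_iteratedDeriv_xiSq_eq_zero hz hre) (not_le.2 hnorm)

end Literature.NumberTheory.LFunctions

end
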